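import Summits.ResolutionOfSingularities.ResolutionOfSingularities.Theses.Descent
import Summits.ResolutionOfSingularities.ResolutionOfSingularities.Theses.EscapeRate
import Summits.ResolutionOfSingularities.ResolutionOfSingularities.Theses.RadicialJung
import Summits.ResolutionOfSingularities.ResolutionOfSingularities.Theorems.DescentDescentPerfectToAllOfCleanModelsDimGEFour
import Summits.ResolutionOfSingularities.ResolutionOfSingularities.Theorems.RadicialJungCleanModelsCleanLU3DimThreeCentre
import Literature.AlgebraicGeometry.CossartPiltant200819.Thm15FrameSHE2019
import Literature.AlgebraicGeometry.Resolution.LocalBlowup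
import Literature.AlgebraicGeometry.Resolution.ExcellentRings
import Literature.AlgebraicGeometry.Resolution.SandwichedWeakPatching
import Literature.AlgebraicGeometry.Resolution.ArithmeticalThreefoldsLocal
import Literature.AlgebraicGeometry.Resolution.RegularDerivationQuotient
import Literature.AlgebraicGeometry.Resolution.RegularLocalRingsProofs
import Literature.AlgebraicGeometry.Resolution.DerivativeIdealsLocalization
import Summits.ResolutionOfSingularities.ResolutionOfSingularities.Theorems.RadicialJungCleanModelsCleanPatchingDefs
import Summits.ResolutionOfSingularities.ResolutionOfSingularities.Theorems.WeightedInvariantDescentPerfectToAllOneRootCoreReduction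
import Summits.ResolutionOfSingularities.ResolutionOfSingularities.Theorems.WeightedInvariantDescentPerfectToAllPicoverLink
import Summits.ResolutionOfSingularities.ResolutionOfSingularities.Theorems.RadicialJungCleanModelsSufficeFrame
import Literature.AlgebraicGeometry.Resolution.NormalizationInExtension
import HarnessLib

/-!
# Crux `DescentPerfectToAll` (stmt-ResolutionOfSingularities-0549) — line `via-cp-frame`, rev 2.3 (lens 5 «transfer from the solved sibling»,
# res-B-lens-5 g4, 2026-08-28): the ANTECEDENT-HONEST cut.  Answers, in place, critic TRIAGE-7 §B4 (flag «S4 antecedent-free», stub-misstated, minor)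
# and the ROUND-VERDICT NOTE of VERDICT-provisional («every clean-currency cut of B|_{≥4} charges rung B over PERFECT fields with cleaning of a
# `p`-radicand on a regular model in `dim ≥ 4` — embedded-resolution-type, not known from non-embedded `PerfectRes p`»).
#
# Status of record (unchanged): BOOKED AS SUB-SKELETON of the slot line `via-clean-models` rev 3 (lead res-B-lead-1), whose research stub
# `ViaCleanModels.stub_cleanModelsDimGEFour` is `CleanModelsDimGEFour` below; not a competing line; [OURS · CANDIDATE] counted 0.
#
# WHAT REV 2.3 CHANGES.  Rung B is the implication `PerfectRes_p → ResolutionInChar p` (`descentPerfectToAll_iff_perfectResAt`, `Iff.rfl`).  Rev ≤ 2.2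
# (and the slot line) reach it through the landed G1 `Theorems.descentPerfectToAll_of_cleanModelsDimGEFour` (p654205), whose hypothesis
# `CleanModels|_{dim W ≥ 4}` quantifies over ALL ground fields `k` of characteristic `p`: the cut silently charged rung B with «a regular model
# cleaning a `p`-radicand over a regular `W/k`, `k` PERFECT, `dim W ≥ 4`» (never paid by, and never using, the crux's antecedent).  Rev 2.3 removes
# that charge at the kernel level, with LANDED theorems only:
#   G1″ `descentPerfectToAll_of_cleanModelsImperfect` (NO sorry):
#       `CossartPiltant2019 → (∀ p prime, PerfectRes_p → CleanModels|_{dim W ≥ 4, k IMPERFECT}) → DescentPerfectToAll`,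
#   through `Theorems.descentPerfectToAll_of_oneRootStepCore` ∘ `oneRootStepCore_of_radicialBottom` ∘ `picoverToRadicialBottom_proof` (stmt-0556,
#   proved) ∘ `RadicialJung.CleanModelsSuffice.picoverAt_of_degPAt` (Temkin's degree-`p` tower), the degree-`p` residue `DegP_p(k; W, L)` («the
#   normalisation `W^L` of a regular integral separated finite-type `k`-scheme `W` in a degree-`p` purely inseparable `L/K(W)` has a resolution»)
#   being discharged by a THREE-WAY split (`degPAt_of_perfectResAt_of_cleanModelsImperfectAt`, no sorry):
#     `k` perfect   ↦ the ANTECEDENT `PerfectRes_p` itself, applied to `W^L` — a reduced (integral) separated `k`-scheme of finite type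
#                     (`normalizationInι W L ≫ f`; finiteness `isFinite_normalizationInι`): no cleaning, no Cossart–Piltant, every dimension;
#     `dim W ≤ 3`   ↦ the solved sibling: `Picover.DegPDimLeThree.picoverDegP_of_dim_le_three` (CP 2019 Thm 1.1 = named fact S1; `dim W^L = dim W`);
#     otherwise     ↦ a pointwise log-clean regular model from the IMPERFECT-ground-field statement + the PROVED item `RadicialJung.CleanResolves`
#                     (`cleanResolves_proof`, stmt-16286: exceptionalisation + Kato 1994 (10.4)).
#   Register sentence after rev 2.3: rung B = `CleanModels|_{dim W ≥ 4, k imperfect}` GUARDED by `PerfectRes_p`, modulo CP 2019.  The same free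
#   upgrade applies verbatim to the slot line: `cleanModelsDimGEFour_iff_perfectAt_and_imperfectAt` (L1's stub = perfect half ∧ imperfect half, no
#   sorry) — only the imperfect half is load-bearing for rung B; the perfect half, guarded, is typed below as the critic's de-risk target
#   `CleanModelsPerfectOfPerfectRes` («resolution ⟹ clean models over perfect fields, `dim ≥ 4`»; NOT a stub of this line, not used by G1″).
#
# THE FOUR REGISTERED STUBS (rev 2.3; S2′/S3′/S4′ replace rev 2.2's S2/S3/S4, which stay as statements with one-line certificates S2 ⟹ S2′, S4 ⟹ S4′):
#   S1  `stub_cossartPiltant2019`                    — named printed fact (CP 2019 Thm 1.1); SAME name and signature as the slot line (rev 3).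
#   S2′ `stub_cleanLUImperfectDimGEFour`             — `∀ p prime, PerfectRes_p → ∀ n ≥ 4, CleanLUAtDimImperfectAt p n`: clean local uniformization at
#                                                     centres of local dimension `n ≥ 4` of function fields over IMPERFECT ground fields of
#                                                     characteristic `p`, resolution over all perfect fields of characteristic `p` being GIVEN.
#                                                     OPEN; ON `DimensionFourFrontier`.  HARDEST (local).
#   S3′ `stub_cleanZariskiGlueImperfect`             — the per-ground-field TRANSFER glue (size L; rev 2.2's S3 route run inside ONE imperfect `k`,
#                                                     which it never leaves: ZR space of `K(W)/k`, `k`-models; every ingredient has a landed `P_reg`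
#                                                     twin): clean LU (imperfect `k`, `n ≥ 4`) + clean weak-sandwiched atom (imperfect `k`) ⟹
#                                                     `CleanModels|_{dim ≥ 4, k imperfect}`.  No research content claimed.
#   S4′ `stub_cleanSandwichedWeakImperfectDimGEFour` — `∀ p prime, PerfectRes_p → CleanSandwichedWeakImperfectAt p`: the clean weak-sandwiched atom
#                                                     in dimension `≥ 4` over IMPERFECT ground fields, perfect-field resolution GIVEN.  OPEN;
#                                                     FRONTIER.  HARDEST (global).
# Composition `DescentPerfectToAll_proof := G1″ S1 (fun p hp H ↦ S3′ p hp (S2′ p hp H) (S4′ p hp H))`; no sorry outside the four `stub_*`.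
#
# WHY THE GUARD IS NOT COSTUME, AND WHAT THE TRANSFER LENS ADDS.  `PerfectRes_p` is the crux's HYPOTHESIS, not its conclusion.  Over a perfect
# ground field the stubs of rev 2.3 claim NOTHING (the antecedent pays `DegP_p` there outright); over an imperfect `k` the guard hands the prover
# resolution of every reduced variety over `k^{perf}`, `𝔽_p`, … as a tool — it does NOT pay the imperfect case by base change (crux Disproof §3:
# `Bl_{(x^p − λ, y)} 𝔸² ⊗_k k(λ^{1/p})` has the singular chart `u^p = t·y`; g3 dead end).  The solved sibling (CP 2019: `dim ≤ 3`, ARBITRARY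
# fields) and the antecedent (PERFECT fields, all dimensions) are now used side by side as the two known faces of the `(dimension, ground field)`
# rectangle; the stubs are exactly its open corner `{dim ≥ 4} × {k imperfect}`, in clean currency.
#
# HONEST LIMITS.  (i) «imperfect» is a restriction AS TYPED: an instance over an imperfect `k` may still encode perfect-field geometry
# (`W₀ ⊗_{𝔽_p} 𝔽_p(t)`), so no claim is made that S2′/S4′ are free of embedded-type content — only that the cut no longer CHARGES the perfect-field
# case and that the antecedent is USED.  (ii) Even in the sibling dimension 3 «resolution ⟹ clean models» is not in print (the lead's `CleanLU3` is
# honest-OPEN since the F-110 verdict), so the de-risk target has no dimension-3 precedent to transfer from: recorded, not claimed.  (iii) S2′, S4′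
# remain ON `Literature.Barriers.ResolutionOfSingularities.DimensionFourFrontier`; nothing here evades it.  (iv) `descentPerfectToAll_of_oneRootStepCore`
# is typed globally in `p` although every step uses its hypothesis at the prime in scope; irrelevant for the cut.
#
# REV ≤ 2.2 RECORD kept below (all kernel-checked where marked): F-110 FALSE AS TYPED, transported (`cpFrameAtDim_three_iff`, `not_cpFrameAtDim_three`;
# rev 1's S2 STUB-FALSE: witness `𝔽₅[x,y,w,…]`, `f = x²y`, golden valuation); (β) re-typed `CleanLUAtDim n`; S4 ≡ clean two-model patching modulo
# Nagata (`CleanTwoModelPatchingDimGEFour`); certificate (1) `sandwichedWeakOverCleanPairs_of_cleanSandwichedWeak` (S4 contains `P_reg` weak resolution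
# of `d`-folds proper birational over everywhere-clean bases, `d ≥ 4`); the DERIVATION CERTIFICATE OF CLEANNESS (rev 2.2): `cleanRegAt_of_derivation_isUnit`,
# `cleanRegAt_X_localization_mvPolynomial` (`(𝔸ᵈ_k, x_i^{1/p})` is an everywhere-clean pair at ring level); candidate sub-cut `CpCoverLUAtDim n` +
# `CleanDescentAtDim n` (typed, NOT registered); rev 2.2's composition through G1 (`DescentPerfectToAll_of_rev22`).
#
# [OURS · CANDIDATE] counted 0.  Resolution of singularities in characteristic `p` is NOT proved by anything here; rung B (`DescentPerfectToAll`),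
# S2′, S4′ and `CleanModels` in `dim ≥ 3` remain OPEN; Hironaka 2017 is not cited.  AI-typed; weaker than expert review.
-/

noncomputable section

set_option linter.dupNamespace false

open CategoryTheory AlgebraicGeometry
open Literature.AlgebraicGeometry.Resolution

namespace Summit.ResolutionOfSingularities.ResolutionOfSingularities.Cruxes.DescentPerfectToAll.ViaCpFrame

/-- **Cossart–Piltant's base-side frame at dimension `n`** (Thm 1.5 (i) + Prop 2.22 of J. Algebra 529 (2019), typed as INPUTS
F-110 `CossartPiltant2019_thm_1_5_i_frame` with `ringKrullDim S = 3` replaced by `ringKrullDim S = n`): for every excellent regular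
local ring `S` of characteristic `p` and dimension `n`, every `f ∈ S` with `f ∉ Frac(S)^p` and every valuation ring `O` of
`K = Frac S` dominating `S`, there is a finite tower of local blowing ups along regular centres `S = B 0 ≤ ⋯ ≤ B r ≤ O` and
radicands `g i ∈ B i` on the `K^p`-line of `f` (`g (i+1) = c^p g i + d^p`, `c ≠ 0`) with `(B r)[X]/(X^p - g r)` regular.
KEPT AS A SETTLED NEGATIVE EDGE: F-110 is FALSE AS TYPED (its END clause over-reads CP 2019 — Cor. 5.6 p. 405 sends multiplicity `< p`
points outside Prop. 2.22's degree-`p` frame; witness `𝔽₅[x,y,w,…]`, `f = x²y`, golden valuation, VERDICT-F110-challenge.md), hence so is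
`CpFrameAtDim n` for every `n ≥ 2` (same witness with `n − 2` passive variables).  Not used by any stub of rev 2.
[cite: CossartPiltant2019, Thm. 1.5 (i), Prop. 2.22, Cor. 5.6] -/
def CpFrameAtDim (n : ℕ) : Prop :=
  ∀ (p : ℕ), p.Prime →
    ∀ (S : Type) [CommRing S] [IsRegularLocalRing S],
      IsExcellentRing S → ringKrullDim S = (n : WithBot ℕ∞) → CharP S p →
    ∀ (K : Type) [Field K] [Algebra S K] [IsFractionRing S K] (f : S),
      (∀ c : K, c ^ p ≠ algebraMap S K f) →
    ∀ (O : ValuationSubring K), (algebraMap S K).range ≤ O.toSubring →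
      (∀ s ∈ IsLocalRing.maximalIdeal S, O.valuation (algebraMap S K s) < 1) →
    ∃ (r : ℕ) (B : ℕ → Subring K) (g : ℕ → K),
      B 0 = locAtCentre (algebraMap S K).range O ∧ g 0 = algebraMap S K f ∧
      (∀ i ≤ r, B i ≤ O.toSubring ∧ IsRegularLocalRing (B i) ∧ g i ∈ B i) ∧
      (∀ i < r, ∃ P : Ideal (B i), IsRegularLocalRing ((B i) ⧸ P) ∧
        IsLocalBlowupAlong O (B i) P (B (i + 1)) ∧
        ∃ c d : K, c ≠ 0 ∧ g (i + 1) = c ^ p * g i + d ^ p) ∧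
      ∀ hg : g r ∈ B r, IsRegularLocalRing (AdjoinRoot (Polynomial.X ^ p - Polynomial.C (⟨g r, hg⟩ : B r)))

/-- **Clean local uniformization at centres of local dimension `n`** — the conclusion shape of the lead's `CleanLU3`
(`cleanLU_of_frame_of_dimThreeCentre`, p659057; `cleanLU_of_cleanLU3_dimThreeCentres`, p660825) with `3 ↦ n`: for a field `k` of
characteristic `p`, a valuation ring `O` of `K ⊇ k`, a finitely generated `A ⊆ O` with `Frac A = K` regular of dimension `n` at the
centre of `O`, and `g₀ ∉ K^p`, some finitely generated `A ⊆ A' ⊆ O` is regular at the centre of `O` and carries there a loosely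
clean NON-TRIVIAL representative `∑ c_j^p g₀^j` of the `K^p`-line of `g₀` (three loose-clean forms).  This is re-open input (β) «DOOR 2 over
arbitrary residue fields» AS RE-TYPED by registrar #4e / critic (20:54Z) after the F-110 verdict; untouched by the F-110 witness (`x²y` is
form-1 clean at `S`). [folklore] -/
def CleanLUAtDim (n : ℕ) : Prop :=
  ∀ (p : ℕ), p.Prime → ∀ (k : Type) [Field k] [CharP k p] (K : Type) [Field K] [Algebra k K]
    (O : ValuationSubring K) (A : Subalgebra k K), A.toSubring ≤ O.toSubring → A.FG → IsFractionRing A K →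
    IsRegularLocalRing (locAtCentre A.toSubring O) →
    ringKrullDim (locAtCentre A.toSubring O) = (n : WithBot ℕ∞) →
    ∀ g₀ : K, (∀ c : K, c ^ p ≠ g₀) →
    ∃ (A' : Subalgebra k K), A'.toSubring ≤ O.toSubring ∧ A ≤ A' ∧ A'.FG ∧
      ∃ (_ : IsRegularLocalRing (locAtCentre A'.toSubring O)) (c : Fin p → K),
        (∃ j : Fin p, (j : ℕ) ≠ 0 ∧ c j ≠ 0) ∧
        ((∃ (d m : ℕ) (hmd : m ≤ d) (t : Fin d → ↥(locAtCentre A'.toSubring O)) (a : Fin m → ℕ)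
            (u : ↥(locAtCentre A'.toSubring O)), IsUnit u ∧
            Ideal.span (Set.range t) = IsLocalRing.maximalIdeal ↥(locAtCentre A'.toSubring O) ∧
            ringKrullDim ↥(locAtCentre A'.toSubring O) = (d : WithBot ℕ∞) ∧ 0 < m ∧ (∀ i, ¬ p ∣ a i) ∧
            (∑ j : Fin p, c j ^ p * g₀ ^ (j : ℕ)) =
              (u : K) * ∏ i : Fin m, ((t (Fin.castLE hmd i) : ↥(locAtCentre A'.toSubring O)) : K) ^ (a i)) ∨
          (∃ u : ↥(locAtCentre A'.toSubring O), IsUnit u ∧ (∑ j : Fin p, c j ^ p * g₀ ^ (j : ℕ)) = (u : K) ∧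
            ∀ c' : ↥(locAtCentre A'.toSubring O), u - c' ^ p ∉ IsLocalRing.maximalIdeal ↥(locAtCentre A'.toSubring O)) ∨
          (∃ s c' : ↥(locAtCentre A'.toSubring O), (∑ j : Fin p, c j ^ p * g₀ ^ (j : ℕ)) = (s : K) ∧
            s - c' ^ p ∈ IsLocalRing.maximalIdeal ↥(locAtCentre A'.toSubring O) ∧
            s - c' ^ p ∉ IsLocalRing.maximalIdeal ↥(locAtCentre A'.toSubring O) ^ 2))

/-- **`RadicialJung.CleanModels` restricted to `dim W ≥ 4`** — VERBATIM the statement of the live line's research stub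
`ViaCleanModels.stub_cleanModelsDimGEFour` (rev 3) = hypothesis `h4` of the landed G1
`Theorems.descentPerfectToAll_of_cleanModelsDimGEFour` (p654205). [cite: HauserPerlega2019; CossartPiltant2019] -/
def CleanModelsDimGEFour : Prop :=
  ∀ p : ℕ, p.Prime → ∀ (k : Type) [Field k] [CharP k p] (W : AlgebraicGeometry.Scheme.{0}) [AlgebraicGeometry.IsIntegral W] (f : W ⟶ AlgebraicGeometry.Spec (.of k)) (L : Type) [Field L] [Algebra W.functionField L], AlgebraicGeometry.IsSeparated f → AlgebraicGeometry.LocallyOfFiniteType f → AlgebraicGeometry.QuasiCompact f → Literature.AlgebraicGeometry.Resolution.Scheme.IsRegular W → IsPurelyInseparable W.functionField L → Module.finrank W.functionField L = p → ¬ topologicalKrullDim W ≤ 3 → ∃ (V : AlgebraicGeometry.Scheme.{0}) (π : V ⟶ W) (_ : AlgebraicGeometry.IsIntegral V) (_ : AlgebraicGeometry.IsDominant π), AlgebraicGeometry.IsProper π ∧ Literature.AlgebraicGeometry.Resolution.IsBirational π ∧ Literature.AlgebraicGeometry.Resolution.Scheme.IsRegular V ∧ (∀ v : V, (∃ (y :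 L) (g : W.functionField), y ∉ Set.range (algebraMap W.functionField L) ∧ algebraMap W.functionField L g = y ^ p ∧ ((∃ (d m : ℕ) (hmd : m ≤ d) (t : Fin d → V.presheaf.stalk v) (a : Fin m → ℕ), Ideal.span (Set.range t) = IsLocalRing.maximalIdeal (V.presheaf.stalk v) ∧ ringKrullDim (V.presheaf.stalk v) = (d : WithBot ℕ∞) ∧ 0 < m ∧ (∀ i, ¬ p ∣ a i) ∧ Literature.AlgebraicGeometry.Motives.RatFn.functionFieldMap π g = ∏ i : Fin m, (algebraMap (V.presheaf.stalk v) V.functionField (t (Fin.castLE hmd i))) ^ (a i)) ∨ (∃ u₀ : V.presheaf.stalk v, IsUnit u₀ ∧ Literature.AlgebraicGeometry.Motives.RatFn.functionFieldMap π g = algebraMap (V.presheaf.stalk v) V.functionField u₀ ∧ ((∀ c : V.presheaf.stalk v, u₀ - c ^ p ∉ IsLocalRing.maximalIdeal (V.presheaf.stalk v)) ∨ (∃ c : V.presheaf.stalk v, u₀ - c ^ p ∈ IsLocalRing.maximalIdeal (V.presheaf.stalk v) ∧ u₀ - c ^ p ∉ IsLocalRing.maximalIdeal (V.presheaf.stalk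 v) ^ 2))))))

/-! ## The clean-pair regularity property `P_clean` along a `W`-scheme (new in rev 1.2) -/

/-- **The pointwise clause of `CleanModelsDimGEFour`, VERBATIM, abstracted over the `W`-scheme `ρ : X → W` (dominant, `W`, `X`
integral) and the point `x`**: some `y ∈ L ∖ K(W)` with `g := y^p ∈ K(W)` whose pull-back to `K(X)` is, in `𝒪_{X,x}`, loosely
log-clean — form 1: a monomial `∏_{i<m} t_i^{a_i}` (`m > 0`, `p ∤ a_i`) in a regular system of parameters `t`; form 2: a unit `u₀`
with `u₀ - c^p ∉ 𝔪` for all `c`; form 3: a unit `u₀` with some `u₀ - c^p ∈ 𝔪 ∖ 𝔪²`.  (`P_clean` at `x` := `𝒪_{X,x}` regular ∧ this.)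
[folklore] -/
def LineCleanAlong (W : Scheme.{0}) [IsIntegral W] (L : Type) [Field L] [Algebra W.functionField L] (p : ℕ)
    (X : Scheme.{0}) [IsIntegral X] (ρ : X ⟶ W) [IsDominant ρ] (x : X) : Prop :=
  ∃ (y : L) (g : W.functionField), y ∉ Set.range (algebraMap W.functionField L) ∧ algebraMap W.functionField L g = y ^ p ∧
    ((∃ (d m : ℕ) (hmd : m ≤ d) (t : Fin d → X.presheaf.stalk x) (a : Fin m → ℕ),
        Ideal.span (Set.range t) = IsLocalRing.maximalIdeal (X.presheaf.stalk x) ∧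
        ringKrullDim (X.presheaf.stalk x) = (d : WithBot ℕ∞) ∧ 0 < m ∧ (∀ i, ¬ p ∣ a i) ∧
        Literature.AlgebraicGeometry.Motives.RatFn.functionFieldMap ρ g =
          ∏ i : Fin m, (algebraMap (X.presheaf.stalk x) X.functionField (t (Fin.castLE hmd i))) ^ (a i)) ∨
     (∃ u₀ : X.presheaf.stalk x, IsUnit u₀ ∧
        Literature.AlgebraicGeometry.Motives.RatFn.functionFieldMap ρ g = algebraMap (X.presheaf.stalk x) X.functionField u₀ ∧
        ((∀ c : X.presheaf.stalk x, u₀ - c ^ p ∉ IsLocalRing.maximalIdeal (X.presheaf.stalk x)) ∨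
         (∃ c : X.presheaf.stalk x, u₀ - c ^ p ∈ IsLocalRing.maximalIdeal (X.presheaf.stalk x) ∧
            u₀ - c ^ p ∉ IsLocalRing.maximalIdeal (X.presheaf.stalk x) ^ 2))))

/-- `CleanModelsDimGEFour` IS «every `(W, L)` with `W` regular of dimension `≥ 4` has a proper birational regular `W`-model on
which `LineCleanAlong` holds at every point» — definitional unfolding (certificate that `LineCleanAlong` is the register's clause).
[folklore] -/
theorem cleanModelsDimGEFour_iff_lineCleanAlong :
    CleanModelsDimGEFour ↔
      ∀ p : ℕ, p.Prime → ∀ (k : Type) [Field k] [CharP k p] (W : Scheme.{0}) [IsIntegral W] (f : W ⟶ Spec (.of k))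
        (L : Type) [Field L] [Algebra W.functionField L],
        IsSeparated f → LocallyOfFiniteType f → QuasiCompact f → Literature.AlgebraicGeometry.Resolution.Scheme.IsRegular W →
        IsPurelyInseparable W.functionField L → Module.finrank W.functionField L = p → ¬ topologicalKrullDim W ≤ 3 →
        ∃ (V : Scheme.{0}) (π : V ⟶ W) (_ : IsIntegral V) (_ : IsDominant π),
          IsProper π ∧ Literature.AlgebraicGeometry.Resolution.IsBirational π ∧
          Literature.AlgebraicGeometry.Resolution.Scheme.IsRegular V ∧ ∀ v : V, LineCleanAlong W L p V π v :=
  Iff.rfl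

/-- **S4's statement — the CLEAN WEAK-SANDWICHED ATOM in dimension `≥ 4`** (transfer of the tree's `SandwichedWeakResolution p`,
`Literature/AlgebraicGeometry/Resolution/SandwichedWeakPatching.lean`, from `P_reg` to `P_clean`, relative to a regular base `W`):
for a field `k` of characteristic `p`, a regular integral separated `k`-scheme of finite type `W` of dimension `≥ 4`, a degree-`p`
purely inseparable `L / K(W)`, an integral `ρX : X → W` separated of finite type birational, an integral REGULAR `ρU : U → W` separated
of finite type birational on which the line is loosely clean at EVERY point, an open `V ⊆ X` with `η : V → U` proper birational over
`W`, and `X` clean (`P_clean`) at every point outside `V` — there is `π : N → X` proper birational with `N` integral, regular, and the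
line loosely clean at every point of `N`.  OPEN in every dimension `≥ 4` (its `P_reg` shadow already is: Piltant 2013 p. 1–2; CP 2019
Thm 1.1 is the dimension-3 `P_reg` case).  Why it might fail: it contains `P_reg` weak resolution of all integral schemes proper
birational over `𝔸ᵈ_k`, `d ≥ 4` (`sandwichedWeakOverCleanPairs_of_cleanSandwichedWeak` + cleanness of `(𝔸ᵈ, x₁^{1/p})`).
[cite: Piltant2013, Thm. 1.1, p. 1-2; CossartPiltant2019, Thm. 1.1] -/
def CleanSandwichedWeakDimGEFour : Prop :=
  ∀ p : ℕ, p.Prime → ∀ (k : Type) [Field k] [CharP k p] (W : Scheme.{0}) [IsIntegral W] (f : W ⟶ Spec (.of k))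
    (L : Type) [Field L] [Algebra W.functionField L],
    IsSeparated f → LocallyOfFiniteType f → QuasiCompact f → Literature.AlgebraicGeometry.Resolution.Scheme.IsRegular W →
    IsPurelyInseparable W.functionField L → Module.finrank W.functionField L = p → ¬ topologicalKrullDim W ≤ 3 →
    ∀ (X : Scheme.{0}) [IsIntegral X] (ρX : X ⟶ W) [IsDominant ρX],
      IsSeparated ρX → LocallyOfFiniteType ρX → QuasiCompact ρX → Literature.AlgebraicGeometry.Resolution.IsBirational ρX →
    ∀ (U : Scheme.{0}) [IsIntegral U] (ρU : U ⟶ W) [IsDominant ρU],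
      IsSeparated ρU → LocallyOfFiniteType ρU → QuasiCompact ρU → Literature.AlgebraicGeometry.Resolution.IsBirational ρU →
      Literature.AlgebraicGeometry.Resolution.Scheme.IsRegular U → (∀ u : U, LineCleanAlong W L p U ρU u) →
    ∀ (V : X.Opens) (η : (V : Scheme.{0}) ⟶ U), IsProper η → Literature.AlgebraicGeometry.Resolution.IsBirational η →
      η ≫ ρU = V.ι ≫ ρX →
      (∀ x : X, x ∉ V → IsRegularLocalRing (X.presheaf.stalk x) ∧ LineCleanAlong W L p X ρX x) →
    ∃ (N : Scheme.{0}) (π : N ⟶ X) (_ : IsIntegral N) (_ : IsDominant π) (_ : IsDominant (π ≫ ρX)),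
      IsProper π ∧ Literature.AlgebraicGeometry.Resolution.IsBirational π ∧
      Literature.AlgebraicGeometry.Resolution.Scheme.IsRegular N ∧ ∀ n : N, LineCleanAlong W L p N (π ≫ ρX) n

/-- **Clean two-model patching over `W` in dimension `≥ 4`** (transfer of `ProperModel.TwoModelPatching p`, Piltant 2013 Prop. 5.1
with `P = P_clean`): any two integral proper birational `W`-schemes `M₁, M₂` (`W`, `L` as above) are dominated by an integral `N`,
proper birational over `M₁` and over `W` compatibly, such that every point of `N` lying over a `P_clean`-point of `M₁` OR of `M₂` is a
`P_clean`-point of `N`.  Equivalent to `CleanSandwichedWeakDimGEFour` modulo Nagata compactification (the transfer of the tree's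
`sandwichedWeakResolution_iff_twoModelPatching`, `NagataCompactification_holds`); typed here for the registrar's dedup against lens 3's
`ViaValuativeConstantStep.TwoModelPatchingImperfectGeFour` (`P_reg`, `ProperModel k K`).  Not a stub. [cite: Piltant2013, Prop. 5.1] -/
def CleanTwoModelPatchingDimGEFour : Prop :=
  ∀ p : ℕ, p.Prime → ∀ (k : Type) [Field k] [CharP k p] (W : Scheme.{0}) [IsIntegral W] (f : W ⟶ Spec (.of k))
    (L : Type) [Field L] [Algebra W.functionField L],
    IsSeparated f → LocallyOfFiniteType f → QuasiCompact f → Literature.AlgebraicGeometry.Resolution.Scheme.IsRegular W →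
    IsPurelyInseparable W.functionField L → Module.finrank W.functionField L = p → ¬ topologicalKrullDim W ≤ 3 →
    ∀ (M₁ : Scheme.{0}) [IsIntegral M₁] (μ₁ : M₁ ⟶ W) [IsDominant μ₁],
      IsProper μ₁ → Literature.AlgebraicGeometry.Resolution.IsBirational μ₁ →
    ∀ (M₂ : Scheme.{0}) [IsIntegral M₂] (μ₂ : M₂ ⟶ W) [IsDominant μ₂],
      IsProper μ₂ → Literature.AlgebraicGeometry.Resolution.IsBirational μ₂ →
    ∃ (N : Scheme.{0}) (φ₁ : N ⟶ M₁) (φ₂ : N ⟶ M₂) (_ : IsIntegral N) (_ : IsDominant (φ₁ ≫ μ₁)),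
      φ₁ ≫ μ₁ = φ₂ ≫ μ₂ ∧ IsProper φ₁ ∧ Literature.AlgebraicGeometry.Resolution.IsBirational φ₁ ∧
      ∀ n : N,
        ((IsRegularLocalRing (M₁.presheaf.stalk (φ₁.base n)) ∧ LineCleanAlong W L p M₁ μ₁ (φ₁.base n)) ∨
          (IsRegularLocalRing (M₂.presheaf.stalk (φ₂.base n)) ∧ LineCleanAlong W L p M₂ μ₂ (φ₂.base n))) →
        IsRegularLocalRing (N.presheaf.stalk n) ∧ LineCleanAlong W L p N (φ₁ ≫ μ₁) n

/-! ## Rev 2.3 — the antecedent-honest cut: per-prime statements over IMPERFECT ground fields, and the antecedent at `p` -/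

/-- **The crux's own antecedent at the prime `p`** (`PerfectRes_p`): every reduced separated scheme of finite type over a PERFECT field of
characteristic `p` has a resolution of singularities.  VERBATIM the hypothesis of `Theses.Descent.DescentPerfectToAll` at `p`
(`descentPerfectToAll_iff_perfectResAt`, `Iff.rfl`) and of `Theorems.descentPerfectToAll_of_oneRootStepCore`. [folklore] -/
def PerfectResAt (p : ℕ) : Prop :=
  ∀ (κ : Type) [Field κ] [CharP κ p] [PerfectField κ] (Z : Scheme.{0}) (h : Z ⟶ Spec (.of κ)),
    IsSeparated h → LocallyOfFiniteType h → QuasiCompact h → IsReduced Z → Scheme.HasResolution Z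

/-- `PICover_p` — VERBATIM the body of route pAlteration's crux `Theses.PAlteration.Picover` (stmt-0554) at the prime `p` (`picover_iff_picoverAt`,
`Iff.rfl`): a finite, universally injective, surjective cover `X → Y` of a regular integral separated finite-type `k`-scheme, `X` integral, has a
resolution. [cite: Temkin2013, Rem. 1.3.5 (ii)] -/
def PicoverAt (p : ℕ) : Prop :=
  ∀ (k : Type) [Field k] [CharP k p] (Y X : Scheme.{0}) (f : Y ⟶ Spec (.of k)) (g : X ⟶ Y),
    IsSeparated f → LocallyOfFiniteType f → QuasiCompact f → IsIntegral Y → Scheme.IsRegular Y → IsIntegral X →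
    IsFinite g → UniversallyInjective g → Function.Surjective g.base → Scheme.HasResolution X

/-- **Clean local uniformization at centres of local dimension `n`, at the prime `p`, over IMPERFECT ground fields** — the body of `CleanLUAtDim n`
at `p` with the extra hypothesis `¬ PerfectField k` on the ground field `k` (`cleanLUAtDimImperfectAt_of_cleanLUAtDim`).  Over a perfect ground
field rev 2.3 claims nothing locally: the degree-`p` residue is paid there by the antecedent (`degPAt_of_perfectResAt_of_cleanModelsImperfectAt`).
[folklore] -/
def CleanLUAtDimImperfectAt (p n : ℕ) : Prop :=
  ∀ (k : Type) [Field k] [CharP k p], ¬ PerfectField k → ∀ (K : Type) [Field K] [Algebra k K]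
    (O : ValuationSubring K) (A : Subalgebra k K), A.toSubring ≤ O.toSubring → A.FG → IsFractionRing A K →
    IsRegularLocalRing (locAtCentre A.toSubring O) →
    ringKrullDim (locAtCentre A.toSubring O) = (n : WithBot ℕ∞) →
    ∀ g₀ : K, (∀ c : K, c ^ p ≠ g₀) →
    ∃ (A' : Subalgebra k K), A'.toSubring ≤ O.toSubring ∧ A ≤ A' ∧ A'.FG ∧
      ∃ (_ : IsRegularLocalRing (locAtCentre A'.toSubring O)) (c : Fin p → K),
        (∃ j : Fin p, (j : ℕ) ≠ 0 ∧ c j ≠ 0) ∧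
        ((∃ (d m : ℕ) (hmd : m ≤ d) (t : Fin d → ↥(locAtCentre A'.toSubring O)) (a : Fin m → ℕ)
            (u : ↥(locAtCentre A'.toSubring O)), IsUnit u ∧
            Ideal.span (Set.range t) = IsLocalRing.maximalIdeal ↥(locAtCentre A'.toSubring O) ∧
            ringKrullDim ↥(locAtCentre A'.toSubring O) = (d : WithBot ℕ∞) ∧ 0 < m ∧ (∀ i, ¬ p ∣ a i) ∧
            (∑ j : Fin p, c j ^ p * g₀ ^ (j : ℕ)) =
              (u : K) * ∏ i : Fin m, ((t (Fin.castLE hmd i) : ↥(locAtCentre A'.toSubring O)) : K) ^ (a i)) ∨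
          (∃ u : ↥(locAtCentre A'.toSubring O), IsUnit u ∧ (∑ j : Fin p, c j ^ p * g₀ ^ (j : ℕ)) = (u : K) ∧
            ∀ c' : ↥(locAtCentre A'.toSubring O), u - c' ^ p ∉ IsLocalRing.maximalIdeal ↥(locAtCentre A'.toSubring O)) ∨
          (∃ s c' : ↥(locAtCentre A'.toSubring O), (∑ j : Fin p, c j ^ p * g₀ ^ (j : ℕ)) = (s : K) ∧
            s - c' ^ p ∈ IsLocalRing.maximalIdeal ↥(locAtCentre A'.toSubring O) ∧
            s - c' ^ p ∉ IsLocalRing.maximalIdeal ↥(locAtCentre A'.toSubring O) ^ 2))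

/-- **`CleanModels|_{dim W ≥ 4}` at the prime `p` over IMPERFECT ground fields** — the body of `CleanModelsDimGEFour` at `p` with `¬ PerfectField k`
(pointwise clause = `LineCleanAlong`, definitionally).  The LOAD-BEARING half of the slot line's stub for rung B
(`cleanModelsDimGEFour_iff_perfectAt_and_imperfectAt`, `descentPerfectToAll_of_cleanModelsImperfect`). [cite: HauserPerlega2019] -/
def CleanModelsDimGEFourImperfectAt (p : ℕ) : Prop :=
  ∀ (k : Type) [Field k] [CharP k p], ¬ PerfectField k → ∀ (W : Scheme.{0}) [IsIntegral W] (f : W ⟶ Spec (.of k))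
    (L : Type) [Field L] [Algebra W.functionField L],
    IsSeparated f → LocallyOfFiniteType f → QuasiCompact f → Literature.AlgebraicGeometry.Resolution.Scheme.IsRegular W →
    IsPurelyInseparable W.functionField L → Module.finrank W.functionField L = p → ¬ topologicalKrullDim W ≤ 3 →
    ∃ (V : Scheme.{0}) (π : V ⟶ W) (_ : IsIntegral V) (_ : IsDominant π),
      IsProper π ∧ Literature.AlgebraicGeometry.Resolution.IsBirational π ∧
      Literature.AlgebraicGeometry.Resolution.Scheme.IsRegular V ∧ ∀ v : V, LineCleanAlong W L p V π v

/-- **`CleanModels|_{dim W ≥ 4}` at the prime `p` over PERFECT ground fields** — the other half of the slot line's stub; NOT load-bearing for rung B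
after rev 2.3 (the antecedent pays `DegP_p` over perfect `k` directly).  Typed for the critic's de-risk target `CleanModelsPerfectOfPerfectRes`.
[cite: HauserPerlega2019] -/
def CleanModelsDimGEFourPerfectAt (p : ℕ) : Prop :=
  ∀ (k : Type) [Field k] [CharP k p], PerfectField k → ∀ (W : Scheme.{0}) [IsIntegral W] (f : W ⟶ Spec (.of k))
    (L : Type) [Field L] [Algebra W.functionField L],
    IsSeparated f → LocallyOfFiniteType f → QuasiCompact f → Literature.AlgebraicGeometry.Resolution.Scheme.IsRegular W →
    IsPurelyInseparable W.functionField L → Module.finrank W.functionField L = p → ¬ topologicalKrullDim W ≤ 3 →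
    ∃ (V : Scheme.{0}) (π : V ⟶ W) (_ : IsIntegral V) (_ : IsDominant π),
      IsProper π ∧ Literature.AlgebraicGeometry.Resolution.IsBirational π ∧
      Literature.AlgebraicGeometry.Resolution.Scheme.IsRegular V ∧ ∀ v : V, LineCleanAlong W L p V π v

/-- **The critic's DE-RISK TARGET** (VERDICT-provisional, ROUND-VERDICT NOTE): «`PerfectRes p → CleanModels_{≥4}|_{perfect k}`» — resolution over
perfect fields of characteristic `p` implies pointwise log-clean regular models of `p`-radicands over regular `W/k`, `k` perfect, `dim W ≥ 4`.  An
embedded-resolution-type statement; no print in any dimension (even for `dim W = 3` «resolution ⟹ clean models» is not in print: the lead's `CleanLU3`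
is honest-OPEN since the F-110 verdict), so the transfer lens has no sibling precedent for it.  After rev 2.3 it is NOT on the cut of this line (G1″
does not use it) but it IS the residual overhead of the slot line's unrestricted stub (`cleanModelsDimGEFour_iff_perfectAt_and_imperfectAt`).
NOT a stub; recorded, not claimed. [folklore] -/
def CleanModelsPerfectOfPerfectRes : Prop :=
  ∀ p : ℕ, p.Prime → PerfectResAt p → CleanModelsDimGEFourPerfectAt p

/-- **The clean weak-sandwiched atom in dimension `≥ 4` at the prime `p` over IMPERFECT ground fields** — the body of `CleanSandwichedWeakDimGEFour`
at `p` with `¬ PerfectField k` (`cleanSandwichedWeakImperfectAt_of_cleanSandwichedWeak`).  S4′'s conclusion. [cite: Piltant2013, Thm. 1.1, p. 1-2] -/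
def CleanSandwichedWeakImperfectAt (p : ℕ) : Prop :=
  ∀ (k : Type) [Field k] [CharP k p], ¬ PerfectField k → ∀ (W : Scheme.{0}) [IsIntegral W] (f : W ⟶ Spec (.of k))
    (L : Type) [Field L] [Algebra W.functionField L],
    IsSeparated f → LocallyOfFiniteType f → QuasiCompact f → Literature.AlgebraicGeometry.Resolution.Scheme.IsRegular W →
    IsPurelyInseparable W.functionField L → Module.finrank W.functionField L = p → ¬ topologicalKrullDim W ≤ 3 →
    ∀ (X : Scheme.{0}) [IsIntegral X] (ρX : X ⟶ W) [IsDominant ρX],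
      IsSeparated ρX → LocallyOfFiniteType ρX → QuasiCompact ρX → Literature.AlgebraicGeometry.Resolution.IsBirational ρX →
    ∀ (U : Scheme.{0}) [IsIntegral U] (ρU : U ⟶ W) [IsDominant ρU],
      IsSeparated ρU → LocallyOfFiniteType ρU → QuasiCompact ρU → Literature.AlgebraicGeometry.Resolution.IsBirational ρU →
      Literature.AlgebraicGeometry.Resolution.Scheme.IsRegular U → (∀ u : U, LineCleanAlong W L p U ρU u) →
    ∀ (V : X.Opens) (η : (V : Scheme.{0}) ⟶ U), IsProper η → Literature.AlgebraicGeometry.Resolution.IsBirational η →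
      η ≫ ρU = V.ι ≫ ρX →
      (∀ x : X, x ∉ V → IsRegularLocalRing (X.presheaf.stalk x) ∧ LineCleanAlong W L p X ρX x) →
    ∃ (N : Scheme.{0}) (π : N ⟶ X) (_ : IsIntegral N) (_ : IsDominant π) (_ : IsDominant (π ≫ ρX)),
      IsProper π ∧ Literature.AlgebraicGeometry.Resolution.IsBirational π ∧
      Literature.AlgebraicGeometry.Resolution.Scheme.IsRegular N ∧ ∀ n : N, LineCleanAlong W L p N (π ≫ ρX) n

/-! ### Certificates for rev 2.3 (kernel-checked, no sorry) -/

/-- Rung B IS `∀ p prime, PerfectRes_p → ResolutionInChar p` — definitional. [folklore] -/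
theorem descentPerfectToAll_iff_perfectResAt :
    Summit.ResolutionOfSingularities.ResolutionOfSingularities.Theses.Descent.DescentPerfectToAll ↔
      ∀ p : ℕ, p.Prime → PerfectResAt p → ResolutionInChar.{0} p :=
  Iff.rfl

/-- Route pAlteration's `Picover` IS `∀ p prime, PicoverAt p` — definitional. [folklore] -/
theorem picover_iff_picoverAt :
    Summit.ResolutionOfSingularities.ResolutionOfSingularities.Theses.PAlteration.Picover ↔ ∀ p : ℕ, p.Prime → PicoverAt p :=
  Iff.rfl

/-- S2 ⟹ S2′ pointwise: unrestricted clean LU at dimension `n` gives the imperfect-ground-field statement at every prime. [folklore] -/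
theorem cleanLUAtDimImperfectAt_of_cleanLUAtDim {n : ℕ} (h : CleanLUAtDim n) (p : ℕ) (hp : p.Prime) :
    CleanLUAtDimImperfectAt p n :=
  fun k _ _ _ => h p hp k

/-- The slot line's stub gives its imperfect half at every prime. [folklore] -/
theorem cleanModelsImperfectAt_of_cleanModelsDimGEFour (h : CleanModelsDimGEFour) (p : ℕ) (hp : p.Prime) :
    CleanModelsDimGEFourImperfectAt p :=
  fun k _ _ _ => h p hp k

/-- The slot line's stub gives its perfect half at every prime. [folklore] -/
theorem cleanModelsPerfectAt_of_cleanModelsDimGEFour (h : CleanModelsDimGEFour) (p : ℕ) (hp : p.Prime) :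
    CleanModelsDimGEFourPerfectAt p :=
  fun k _ _ _ => h p hp k

/-- **The slot line's stub `CleanModels|_{dim ≥ 4}` = perfect half ∧ imperfect half** (excluded middle on `PerfectField k`).  After rev 2.3 only
the imperfect half (guarded by the antecedent) is load-bearing for rung B (`descentPerfectToAll_of_cleanModelsImperfect`). [folklore] -/
theorem cleanModelsDimGEFour_iff_perfectAt_and_imperfectAt :
    CleanModelsDimGEFour ↔
      (∀ p : ℕ, p.Prime → CleanModelsDimGEFourPerfectAt p) ∧ (∀ p : ℕ, p.Prime → CleanModelsDimGEFourImperfectAt p) := by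
  refine ⟨fun h => ⟨cleanModelsPerfectAt_of_cleanModelsDimGEFour h, cleanModelsImperfectAt_of_cleanModelsDimGEFour h⟩,
    fun h => ?_⟩
  intro p hp k _ _ W _ f L _ _ hs hl hq hr hpi hd hdim
  by_cases hk : PerfectField k
  · exact h.1 p hp k hk W f L hs hl hq hr hpi hd hdim
  · exact h.2 p hp k hk W f L hs hl hq hr hpi hd hdim

/-- S4 ⟹ S4′ pointwise: the unrestricted clean weak-sandwiched atom gives the imperfect-ground-field atom at every prime. [folklore] -/
theorem cleanSandwichedWeakImperfectAt_of_cleanSandwichedWeak (h : CleanSandwichedWeakDimGEFour) (p : ℕ) (hp : p.Prime) :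
    CleanSandwichedWeakImperfectAt p :=
  fun k _ _ _ => h p hp k

/-! ### The sorry-free core of rev 2.3: `DegP_p` by the three-way split, `PICover_p`, and G1″ -/

section Rev23Core

open Summit.ResolutionOfSingularities.ResolutionOfSingularities.Theorems

/-- **`DegP_p` from the antecedent, the solved sibling and the imperfect-field clean models** (NO sorry).  For a prime `p`, a field `k` of
characteristic `p`, a regular integral `W` separated of finite type over `k` and a purely inseparable `L/K(W)` of degree `p`, the normalisation
`W^L` has a resolution: if `k` is PERFECT, by the antecedent `PerfectRes_p` applied to `W^L` itself (integral, hence reduced; separated and of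
finite type over `k` since `W^L → W` is finite, `isFinite_normalizationInι`) — no cleaning, any dimension; else if `dim W ≤ 3`, by Cossart–Piltant
(`Picover.DegPDimLeThree.picoverDegP_of_dim_le_three`: `dim W^L = dim W`); else by the pointwise log-clean regular model of the imperfect-field
statement and the PROVED item `RadicialJung.CleanResolves` (`cleanResolves_proof`). [cite: CossartPiltant2019, Thm. 1.1] -/
theorem degPAt_of_perfectResAt_of_cleanModelsImperfectAt (hCP : CossartPiltant2019.{0}) (p : ℕ) (hp : p.Prime)
    (H : PerfectResAt p) (h4 : CleanModelsDimGEFourImperfectAt p) :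
    ∀ (k : Type) [Field k] [CharP k p] (W : Scheme.{0}) [IsIntegral W]
      (f : W ⟶ Spec (.of k)) (L : Type) [Field L] [Algebra W.functionField L],
      IsSeparated f → LocallyOfFiniteType f → QuasiCompact f → Scheme.IsRegular W →
      IsPurelyInseparable W.functionField L → Module.finrank W.functionField L = p →
      Scheme.HasResolution (normalizationIn W L) := by
  intro k _ _ W _ f L _ _ hs hl hq hr hpi hd
  by_cases hk : PerfectField k
  · -- perfect ground field: the ANTECEDENT resolves `W^L` (no cleaning, every dimension)
    haveI : FiniteDimensional W.functionField L := Module.finite_of_finrank_pos (by rw [hd]; exact hp.pos)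
    haveI := hs; haveI := hl; haveI := hq
    haveI : IsFinite (normalizationInι W L) := isFinite_normalizationInι W L f
    haveI : IsSeparated (normalizationInι W L ≫ f) := inferInstance
    haveI : LocallyOfFiniteType (normalizationInι W L ≫ f) := inferInstance
    haveI : QuasiCompact (normalizationInι W L ≫ f) := inferInstance
    exact H k (normalizationIn W L) (normalizationInι W L ≫ f) inferInstance inferInstance inferInstance inferInstance
  · by_cases hdim : topologicalKrullDim W ≤ 3
    · -- the solved sibling (Cossart–Piltant 2019, `dim ≤ 3`, arbitrary fields)
      exact Picover.DegPDimLeThree.picoverDegP_of_dim_le_three hCP p hp k W f L hs hl hq hr hpi hd hdim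
    · -- imperfect ground field, `dim W ≥ 4`: pointwise log-clean regular model + `CleanResolves` (proved)
      obtain ⟨V, π, hVi, hdom, hV⟩ := h4 k hk W f L hs hl hq hr hpi hd hdim
      exact cleanResolves_proof p hp k W f L hs hl hq hr hpi hd V π hV

/-- **`PICover_p` from the antecedent, the sibling and the imperfect-field clean models** (NO sorry): the degree-`p` residue above fed to Temkin's
degree-`p` tower `RadicialJung.CleanModelsSuffice.picoverAt_of_degPAt`. [cite: Temkin2013, Rem. 1.3.5 (ii)] -/
theorem picoverAt_of_perfectResAt_of_cleanModelsImperfectAt (hCP : CossartPiltant2019.{0}) (p : ℕ) (hp : p.Prime)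
    (H : PerfectResAt p) (h4 : CleanModelsDimGEFourImperfectAt p) : PicoverAt p := by
  intro k _ _ Y X f g hsep hlft hqc hY hYreg hX hfin hui hsurj
  exact RadicialJung.CleanModelsSuffice.picoverAt_of_degPAt p hp
    (degPAt_of_perfectResAt_of_cleanModelsImperfectAt hCP p hp H h4) k Y X f g hsep hlft hqc hY hYreg hX hfin hui hsurj

/-- **G1″ — the antecedent-honest glue (NO sorry): Cossart–Piltant + (`PerfectRes_p ⟹ CleanModels|_{dim ≥ 4, k imperfect}` for every prime `p`)
⟹ `DescentPerfectToAll`** (stated on the rfl-equal `EscapeRate` copy, so that exactly one theorem of this file concludes the `Descent` decl).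
Chain, all LANDED: `PICover_p` (above) ⟹ radicial bottom at `p` (`picoverToRadicialBottom_proof`, stmt-0556) ⟹ one-root core at `p`
(`oneRootStepCore_of_radicialBottom`) ⟹ the crux (`descentPerfectToAll_of_oneRootStepCore`: irreducible components, geometric integrality,
perfect closure, limit descent, radicial tower).  The antecedent `H` is consumed twice: by the one-root reduction (as in G1) AND, new in rev 2.3,
inside `DegP_p` over perfect ground fields. [cite: CossartPiltant2019, Thm. 1.1] -/
theorem descentPerfectToAll_of_cleanModelsImperfect (hCP : CossartPiltant2019.{0})
    (h4 : ∀ p : ℕ, p.Prime → PerfectResAt p → CleanModelsDimGEFourImperfectAt p) :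
    Summit.ResolutionOfSingularities.ResolutionOfSingularities.Theses.EscapeRate.DescentPerfectToAll :=
  fun p hp H =>
    (descentPerfectToAll_of_oneRootStepCore fun q hq Hq =>
      oneRootStepCore_of_radicialBottom q
        (picoverToRadicialBottom_proof q hq.out
          (picoverAt_of_perfectResAt_of_cleanModelsImperfectAt hCP q hq.out Hq (h4 q hq.out Hq)))) p hp H

/-- G1″ with the slot line's guard-free imperfect half (what `ViaCleanModels.stub_cleanModelsDimGEFour` could be weakened to without touching the
rest of the slot skeleton). [cite: CossartPiltant2019, Thm. 1.1] -/
theorem descentPerfectToAll_of_cleanModelsImperfect_unguarded (hCP : CossartPiltant2019.{0})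
    (h4 : ∀ p : ℕ, p.Prime → CleanModelsDimGEFourImperfectAt p) :
    Summit.ResolutionOfSingularities.ResolutionOfSingularities.Theses.EscapeRate.DescentPerfectToAll :=
  descentPerfectToAll_of_cleanModelsImperfect hCP fun p hp _ => h4 p hp

end Rev23Core

/-! ## Certificates (kernel-checked, no sorry) -/

/-- Rev 1's (dead) local object at `n = 3` IS the named fact F-110 as typed (Cossart–Piltant 2019 Thm 1.5 (i) + Prop 2.22 with the over-read
END clause), up to the cast `((3 : ℕ) : WithBot ℕ∞) = 3` — kept so that the F-110 verdict transports (`not_cpFrameAtDim_three`).  NOT rev 2's S2.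
[cite: CossartPiltant2019, Thm. 1.5 (i), Prop. 2.22] -/
theorem cpFrameAtDim_three_iff :
    CpFrameAtDim 3 ↔ Literature.AlgebraicGeometry.CossartPiltant200819.CossartPiltant2019_thm_1_5_i_frame.{0} := by
  simp only [CpFrameAtDim, Literature.AlgebraicGeometry.CossartPiltant200819.CossartPiltant2019_thm_1_5_i_frame, Nat.cast_ofNat]

/-- Transport of the F-110 verdict: once `¬ CossartPiltant2019_thm_1_5_i_frame` is landed (critic's recommended negative lemma, typed target
`NegationLens6g3.F110False`), rev 1's local object is refuted at `n = 3` by this one-liner. [folklore] -/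
theorem not_cpFrameAtDim_three
    (h : ¬ Literature.AlgebraicGeometry.CossartPiltant200819.CossartPiltant2019_thm_1_5_i_frame.{0}) : ¬ CpFrameAtDim 3 :=
  fun h3 => h (cpFrameAtDim_three_iff.mp h3)

/-! ## Candidate sub-cut of S2 (typed, NOT registered): cover-side LU one dimension up + clean descent -/

/-- **Cossart–Piltant 2019 Thm 1.5, PRINT-FAITHFUL weak local-uniformization form (the tree's `CossartPiltant2019Local`), case (i) (purely
inseparable `h = X^p − f`), with `ringKrullDim S = 3` replaced by `ringKrullDim S = n`**: for an excellent regular local domain `S` of dimension `n`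
with residue characteristic `p`, `K = Frac S`, `L = K(x)` with `x` a root of a monic irreducible `h ∈ S[X]` of degree `p` with `h = X^p + f_p`,
`char K = p`, and a valuation ring `O` of `L` dominating `S`: some finite `t ⊆ O` makes `S[x][t]` regular at the centre of `O`.  COVER-side (blow-ups
of `𝒳 = Spec S[X]/(h)`), exactly as printed for `n = 3`; OPEN for `n ≥ 4` (= LU for purely inseparable degree-`p` hypersurfaces over regular
`n`-dimensional bases; ON `DimensionFourFrontier`).  The F-110 witness does NOT touch it (there the cover resolves at step 1, VERDICT §3).
[cite: CossartPiltant2019, Thm. 1.5] -/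
def CpCoverLUAtDim (n : ℕ) : Prop :=
  ∀ (p : ℕ), p.Prime →
  ∀ (S : Type) [CommRing S] [IsDomain S] [IsRegularLocalRing S],
    IsExcellentRing S → ringKrullDim S = (n : WithBot ℕ∞) → CharP (IsLocalRing.ResidueField S) p →
  ∀ (K : Type) [Field K] [Algebra S K] [IsFractionRing S K]
    (L : Type) [Field L] [Algebra K L] [Algebra S L] [IsScalarTower S K L]
    (h : Polynomial S) (x : L),
    h.Monic → h.natDegree = p → Irreducible (h.map (algebraMap S K)) → Polynomial.aeval x h = 0 →
    Algebra.adjoin K ({x} : Set L) = ⊤ →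
    (CharP K p ∧ ∀ i, 0 < i → i < p → h.coeff i = 0) →
  ∀ (O : ValuationSubring L), (∀ s : S, algebraMap S L s ∈ O) →
    (∀ s ∈ IsLocalRing.maximalIdeal S, O.valuation (algebraMap S L s) < 1) →
    ∃ (t : Finset L) (ht : (Algebra.adjoin S (insert x (t : Set L))).toSubring ≤ O.toSubring),
      IsRegularLocalRing (Localization.AtPrime
        (Ideal.comap (Subring.inclusion ht) (IsLocalRing.maximalIdeal O)))

/-- CERTIFICATE: at `n = 3` the cover-side object IS implied by the landed print-faithful named fact `CossartPiltant2019Local` (case (i) of its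
disjunction).  Kernel-checked, no sorry. [cite: CossartPiltant2019, Thm. 1.5] -/
theorem cpCoverLUAtDim_three_of_local (H : Literature.AlgebraicGeometry.Resolution.CossartPiltant2019Local.{0}) : CpCoverLUAtDim 3 := by
  intro p hp S _ _ _ hexc hdim hchar K _ _ _ L _ _ _ _ h x hmon hdeg hirr hx hadj hcase O hSO hdom
  have hdim3 : ringKrullDim S = 3 := by simpa using hdim
  exact H p hp S hexc hdim3 hchar K L h x hmon hdeg hirr hx hadj (Or.inl hcase) O hSO hdom

/-- **Clean descent at dimension `n`** — the critic's «genuinely new step» (VERDICT-F110-challenge.md §4: «regular cover model along `ν_L` ⟹ CLEAN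
base model along `ν`»), typed as the implication the composition would need: cover-side LU at dimension `n` gives clean base-side LU at centres of
dimension `n`.  Why it might fail: the naive descent `B := R' ∩ K` of a regular cover model `R'` is NOT regular in general (e.g. `R' = k[u,v]`,
`K = k(u^p, v^p, uv)`: `R' ∩ K = k[u^p, v^p, uv]`, an `A_{p-1}` point), so a different base model must be built (adapted `p`-bases à la
Kimura–Niitsuma where `R'` is `F`-finite; arbitrary `k` needs a relative version).  No print in any dimension.  NOT a registered stub. [folklore] -/
def CleanDescentAtDim (n : ℕ) : Prop := CpCoverLUAtDim n → CleanLUAtDim n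

/-- The candidate sub-cut composes to S2 (bookkeeping, no sorry): cover LU and clean descent in every dimension `≥ 4` give (β) re-typed. [folklore] -/
theorem cleanLUDimGEFour_of_cover_of_descent
    (hc : ∀ n : ℕ, 4 ≤ n → CpCoverLUAtDim n) (hd : ∀ n : ℕ, 4 ≤ n → CleanDescentAtDim n) :
    ∀ n : ℕ, 4 ≤ n → CleanLUAtDim n :=
  fun n hn => hd n hn (hc n hn)

/-- **The `P_reg` shadow of S4** — the tree's `SandwichedWeakResolution p` restricted to dimension `≥ 4`, to bases `U` birational to a
regular `W` and carrying an everywhere-clean degree-`p` radicial line, and to `X` clean off `V`; conclusion: plain weak resolution of `X`.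
With `X = V` it reads: every integral scheme PROPER birational over such a `U` has a resolution — e.g. over `U = 𝔸ᵈ_k` (`d ≥ 4`, any
field `k` of characteristic `p`; `(𝔸ᵈ, x₁^{1/p})` is clean at every scheme point), i.e. weak resolution of all `d`-folds proper and
birational over affine `d`-space: a slice of route Valuative's OPEN atom (`PatchingRel`, stmt-0642) in dimension `≥ 4`.
[cite: Piltant2013, Thm. 1.1, p. 1-2] -/
def SandwichedWeakOverCleanPairsDimGEFour : Prop :=
  ∀ p : ℕ, p.Prime → ∀ (k : Type) [Field k] [CharP k p] (W : Scheme.{0}) [IsIntegral W] (f : W ⟶ Spec (.of k))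
    (L : Type) [Field L] [Algebra W.functionField L],
    IsSeparated f → LocallyOfFiniteType f → QuasiCompact f → Literature.AlgebraicGeometry.Resolution.Scheme.IsRegular W →
    IsPurelyInseparable W.functionField L → Module.finrank W.functionField L = p → ¬ topologicalKrullDim W ≤ 3 →
    ∀ (X : Scheme.{0}) [IsIntegral X] (ρX : X ⟶ W) [IsDominant ρX],
      IsSeparated ρX → LocallyOfFiniteType ρX → QuasiCompact ρX → Literature.AlgebraicGeometry.Resolution.IsBirational ρX →
    ∀ (U : Scheme.{0}) [IsIntegral U] (ρU : U ⟶ W) [IsDominant ρU],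
      IsSeparated ρU → LocallyOfFiniteType ρU → QuasiCompact ρU → Literature.AlgebraicGeometry.Resolution.IsBirational ρU →
      Literature.AlgebraicGeometry.Resolution.Scheme.IsRegular U → (∀ u : U, LineCleanAlong W L p U ρU u) →
    ∀ (V : X.Opens) (η : (V : Scheme.{0}) ⟶ U), IsProper η → Literature.AlgebraicGeometry.Resolution.IsBirational η →
      η ≫ ρU = V.ι ≫ ρX →
      (∀ x : X, x ∉ V → IsRegularLocalRing (X.presheaf.stalk x) ∧ LineCleanAlong W L p X ρX x) →
    Literature.AlgebraicGeometry.Resolution.Scheme.HasResolution X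

/-- CERTIFICATE (1) of the header: **S4 ⟹ its `P_reg` shadow** — the clean weak-sandwiched atom contains plain weak resolution of
sandwiched schemes over clean-pair bases in dimension `≥ 4` (forget the clean clause of the conclusion).  Kernel-checked, no sorry.
[cite: Piltant2013, Thm. 1.1] -/
theorem sandwichedWeakOverCleanPairs_of_cleanSandwichedWeak (h : CleanSandwichedWeakDimGEFour) :
    SandwichedWeakOverCleanPairsDimGEFour := by
  intro p hp k _ _ W _ f L _ _ hfs hfl hfq hW hpi hdeg h4 X _ ρX _ hXs hXl hXq hXb U _ ρU _ hUs hUl hUq hUb hU hUc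
    V η hηp hηb hcomm hout
  obtain ⟨N, π, _, _, _, hπp, hπb, hN, -⟩ :=
    h p hp k W f L hfs hfl hfq hW hpi hdeg h4 X ρX hXs hXl hXq hXb U ρU hUs hUl hUq hUb hU hUc V η hηp hηb hcomm hout
  exact ⟨N, π, ⟨hπp, hπb, hN⟩⟩

/-! ## Certificate (3) (rev 2.2, kernel-checked, no sorry): the derivation criterion for cleanness; affine space is everywhere clean for a coordinate -/

section DerivationCertificate

open IsLocalRing
open Summit.ResolutionOfSingularities.ResolutionOfSingularities.Theorems.RadicialJung.CleanModels (LooseCleanForm CleanRegAt)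

variable {R : Type*} [CommRing R]

/-- In a regular local ring, an element of `𝔪 ∖ 𝔪²` is the first member of a regular system of parameters
(`exists_span_insert_eq_maximalIdeal` + regularity `emb dim = dim`). [cite: Matsumura1987, Thm. 14.2] -/
theorem exists_regularParameters_head_of_not_mem_sq [IsRegularLocalRing R] {x : R}
    (hx : x ∈ maximalIdeal R) (hx2 : x ∉ maximalIdeal R ^ 2) :
    ∃ (d : ℕ) (t : Fin (d + 1) → R), t 0 = x ∧ Ideal.span (Set.range t) = maximalIdeal R ∧
      ringKrullDim R = ((d + 1 : ℕ) : WithBot ℕ∞) := by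
  classical
  obtain ⟨s, hsfin, hcard, hspan⟩ := exists_span_insert_eq_maximalIdeal hx hx2
  have hreg := (isRegularLocalRing_iff R).mp ‹_›
  have hle : (maximalIdeal R).spanFinrank ≤ s.ncard + 1 := by
    have h1 : (Ideal.span (insert x s)).spanFinrank ≤ (insert x s).ncard :=
      Submodule.spanFinrank_span_le_ncard_of_finite (hsfin.insert x)
    rw [hspan] at h1
    exact h1.trans (Set.ncard_insert_le x s)
  have heq : s.ncard + 1 = (maximalIdeal R).spanFinrank := le_antisymm hcard hle
  -- enumerate `s`
  have hcardF : hsfin.toFinset.card = s.ncard := (Set.ncard_eq_toFinset_card s hsfin).symm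
  let e : hsfin.toFinset ≃ Fin s.ncard := hsfin.toFinset.equivFin.trans (finCongr hcardF)
  let g : Fin s.ncard → R := fun i => ((e.symm i : hsfin.toFinset) : R)
  have hg : Set.range g = s := by
    ext a
    constructor
    · rintro ⟨i, rfl⟩
      exact hsfin.mem_toFinset.mp (e.symm i).2
    · intro ha
      refine ⟨e ⟨a, by simpa [Set.Finite.mem_toFinset] using ha⟩, ?_⟩
      simp [g]
  refine ⟨s.ncard, Fin.cons x g, by simp, ?_, ?_⟩
  · rw [Fin.range_cons, hg, hspan]
  · rw [← hreg, ← heq]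

/-- **Derivation certificate of cleanness (ring level).**  Let `R` be a regular local ring with `p ∈ 𝔪` (residue
characteristic `p`), `D` a derivation of `R` and `x ∈ R` with `D x` a unit.  Then `x` is in one of the three loose clean
positions: `x ∈ 𝔪 ∖ 𝔪²` (hence the head of a regular system of parameters — form 1 with exponent `1`), or `x` is a unit
whose residue is not a `p`-th power (form 2), or `x - c^p ∈ 𝔪 ∖ 𝔪²` for some `c` (form 3).  Proof: Leibniz gives
`D(𝔪²) ⊆ 𝔪` (`not_mem_sq_of_derivation_unit`, Stacks 07PF), and `D(x - c^p) = D x - p c^{p-1} D c ≡ D x (mod 𝔪)`.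
This is the lemma behind «`(𝔸ᵈ_k, x₁^{1/p})` is clean at every scheme point» (`D = ∂/∂x₁`). [cite: StacksProject, Tag 07PF] -/
theorem clean_trichotomy_of_derivation_isUnit [IsRegularLocalRing R] {p : ℕ} (hp : (p : R) ∈ maximalIdeal R)
    {S₀ : Type*} [CommSemiring S₀] [Algebra S₀ R] (D : Derivation S₀ R R) (x : R) (hDx : IsUnit (D x)) :
    (x ∈ maximalIdeal R ∧ x ∉ maximalIdeal R ^ 2) ∨
    (IsUnit x ∧ ∀ c : R, x - c ^ p ∉ maximalIdeal R) ∨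
    (∃ c : R, x - c ^ p ∈ maximalIdeal R ∧ x - c ^ p ∉ maximalIdeal R ^ 2) := by
  have h1 : (1 : R) ∉ maximalIdeal R :=
    (Ideal.ne_top_iff_one (maximalIdeal R)).mp (IsLocalRing.maximalIdeal.isMaximal R).ne_top
  -- `D y` a unit and `y ∈ 𝔪` ⟹ `y ∉ 𝔪²`
  have key : ∀ y : R, IsUnit (D y) → y ∈ maximalIdeal R → y ∉ maximalIdeal R ^ 2 := by
    intro y hy hym hy2
    have := not_mem_sq_of_derivation_unit y D (hy.map _) (maximalIdeal R) hym (u := 1) h1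
    exact this (by simpa using hy2)
  by_cases hxm : x ∈ maximalIdeal R
  · exact Or.inl ⟨hxm, key x hDx hxm⟩
  · have hxu : IsUnit x := (notMem_maximalIdeal).mp hxm
    by_cases hc : ∀ c : R, x - c ^ p ∉ maximalIdeal R
    · exact Or.inr (Or.inl ⟨hxu, hc⟩)
    · push Not at hc
      obtain ⟨c, hc⟩ := hc
      refine Or.inr (Or.inr ⟨c, hc, key _ ?_ hc⟩)
      -- `D (x - c^p) = D x - p • c^(p-1) • D c` is a unit since `p ∈ 𝔪`
      rw [map_sub, D.leibniz_pow]
      apply (notMem_maximalIdeal).mp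
      intro hmem
      apply (notMem_maximalIdeal).mpr hDx
      have hpm : (p • c ^ (p - 1) • D c : R) ∈ maximalIdeal R := by
        rw [smul_eq_mul, nsmul_eq_mul]
        exact Ideal.mul_mem_right _ _ hp
      have := (maximalIdeal R).add_mem hmem hpm
      simpa using this

/-- The derivation certificate in the register's currency: under the hypotheses of `clean_trichotomy_of_derivation_isUnit`,
`f x` has a LOOSE CLEAN FORM at `R` (lead's `LooseCleanForm`, p666391) for every ring map `f : R → F`. [cite: StacksProject, Tag 07PF] -/
theorem looseCleanForm_of_derivation_isUnit [IsRegularLocalRing R] {F : Type*} [CommRing F] (f : R →+* F) {p : ℕ}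
    (hp : (p : R) ∈ maximalIdeal R) {S₀ : Type*} [CommSemiring S₀] [Algebra S₀ R] (D : Derivation S₀ R R) (x : R)
    (hDx : IsUnit (D x)) : LooseCleanForm p f (f x) := by
  have hp1 : ¬ p ∣ 1 := by
    intro h
    have h1 : p = 1 := Nat.dvd_one.mp h
    rw [h1, Nat.cast_one] at hp
    exact (Ideal.ne_top_iff_one (maximalIdeal R)).mp (IsLocalRing.maximalIdeal.isMaximal R).ne_top hp
  rcases clean_trichotomy_of_derivation_isUnit hp D x hDx with ⟨hxm, hx2⟩ | ⟨hxu, hc⟩ | ⟨c, hc, hc2⟩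
  · obtain ⟨d, t, ht0, hspan, hdim⟩ := exists_regularParameters_head_of_not_mem_sq hxm hx2
    refine Or.inl ⟨d + 1, 1, by omega, t, fun _ => 1, 1, isUnit_one, hspan, hdim, one_pos, fun _ => hp1, ?_⟩
    simp [ht0]
  · exact Or.inr (Or.inl ⟨x, hxu, rfl, hc⟩)
  · exact Or.inr (Or.inr ⟨x, c, rfl, hc, hc2⟩)

/-- … and `P_clean(f x)` holds at `R` with the representative `f x` itself (coefficient vector `e₁`), for `p ≥ 2` and
`F` non-trivial. [cite: Piltant2013, Def. 2.1] -/
theorem cleanRegAt_of_derivation_isUnit [IsRegularLocalRing R] {F : Type*} [CommRing F] [Nontrivial F] (f : R →+* F)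
    {p : ℕ} (hp2 : 2 ≤ p) (hp : (p : R) ∈ maximalIdeal R) {S₀ : Type*} [CommSemiring S₀] [Algebra S₀ R]
    (D : Derivation S₀ R R) (x : R) (hDx : IsUnit (D x)) : CleanRegAt p f (f x) := by
  classical
  refine ⟨‹_›, (Pi.single (⟨1, by omega⟩ : Fin p) (1 : F) : Fin p → F), ⟨⟨1, by omega⟩, by simp, by simp⟩, ?_⟩
  have hsum : (∑ j : Fin p, (Pi.single (⟨1, by omega⟩ : Fin p) (1 : F) : Fin p → F) j ^ p * f x ^ (j : ℕ)) = f x := by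
    rw [Finset.sum_eq_single (⟨1, by omega⟩ : Fin p)]
    · simp
    · intro j _ hj
      simp [hj, zero_pow (by omega : p ≠ 0)]
    · simp
  rw [hsum]
  exact looseCleanForm_of_derivation_isUnit f hp D x hDx

/-- **Every local ring of affine space is clean for a coordinate.**  For a field `k` of characteristic `p ≥ 2`, finitely
many variables `ι`, a variable `i`, and ANY prime `P` of `k[X_ι]` (closed point or not, residue field perfect or not):
`P_clean(X_i)` holds at `k[X_ι]_P`, read in any non-trivial `F` — the representative is `X_i` itself.  Proof: `∂/∂X_i`
extends to the localization (`exists_derivation_extend_of_isLocalization`) and sends `X_i` to `1`.  This is the ring-level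
content of «`(𝔸ᵈ_k, x₁^{1/p})` is an everywhere-clean pair», which prices the clean weak-sandwiched atom S4
(`sandwichedWeakOverCleanPairs_of_cleanSandwichedWeak`). [folklore] -/
theorem cleanRegAt_X_localization_mvPolynomial (k : Type*) [Field k] (p : ℕ) (hp2 : 2 ≤ p) [CharP k p]
    {ι : Type*} [Finite ι] (i : ι) (P : Ideal (MvPolynomial ι k)) [P.IsPrime]
    {F : Type*} [CommRing F] [Nontrivial F] (f : Localization.AtPrime P →+* F) :
    CleanRegAt p f (f (algebraMap (MvPolynomial ι k) (Localization.AtPrime P) (MvPolynomial.X i))) := by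
  haveI : IsRegularRing (MvPolynomial ι k) := inferInstance
  haveI : IsRegularLocalRing (Localization.AtPrime P) := inferInstance
  -- `p = 0` in `k[X]_P`, so `p ∈ 𝔪`
  have hp : ((p : ℕ) : Localization.AtPrime P) ∈ maximalIdeal (Localization.AtPrime P) := by
    have : ((p : ℕ) : Localization.AtPrime P) = 0 := by
      rw [← map_natCast (algebraMap (MvPolynomial ι k) (Localization.AtPrime P)), ← map_natCast MvPolynomial.C,
        CharP.cast_eq_zero k p, map_zero, map_zero]
    rw [this]
    exact Ideal.zero_mem _
  -- `∂/∂X_i` on the localization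
  obtain ⟨D, hD⟩ := exists_derivation_extend_of_isLocalization k (Localization.AtPrime P) P.primeCompl
    (MvPolynomial.pderiv i : Derivation k (MvPolynomial ι k) (MvPolynomial ι k))
  refine cleanRegAt_of_derivation_isUnit f hp2 hp D _ ?_
  rw [hD, MvPolynomial.pderiv_X_self, map_one]
  exact isUnit_one

end DerivationCertificate

/-! ## The four registered stubs (rev 2.3) -/

/-- STUB S1 (named fact of the tree, printed theorem; SAME name and signature as `ViaCleanModels.stub_cossartPiltant2019`, rev 3, and rev ≤ 2.2):
Cossart–Piltant 2019, Thm 1.1 — resolution for reduced separated schemes of finite type of dimension `≤ 3` over any field.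
[cite: CossartPiltant2019, Thm. 1.1] -/
theorem stub_cossartPiltant2019 :
    Literature.AlgebraicGeometry.Resolution.CossartPiltant2019.{0} := by
  sorry

/-- STUB S2′ (OPEN — HARDEST, local; ON `Literature.Barriers.ResolutionOfSingularities.DimensionFourFrontier`): **clean local uniformization at
centres of local dimension `n`, every `n ≥ 4`, for function fields over IMPERFECT ground fields of characteristic `p`, GIVEN resolution of all
reduced varieties over all perfect fields of characteristic `p`** (`PerfectRes_p → ∀ n ≥ 4, CleanLUAtDimImperfectAt p n`; rev 2.2's S2 restricted
to `¬ PerfectField k` and guarded by the crux's antecedent — critic TRIAGE-7 §B4).  Why it might fail / why open: CP 2019 print gives only the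
COVER-side LU of `X^p − g₀` and only for `n = 3` (`CossartPiltant2019Local`); for `n ≥ 4` even that is open (CP 2019 p. 271 «its local variant for
valuations … remains equally unsolved», p. 402), and «regular cover model ⟹ clean base model» is a new step in every dimension (`CleanDescentAtDim`);
the guard does not pay it by base change from `k^{perf}` (crux Disproof §3: `u^p = t·y`).  No counterexample known (the F-110 witness is form-1 clean
at `S`). [cite: CossartPiltant2019, Thm. 1.5, p. 271, p. 402; HauserPerlega2019] -/
theorem stub_cleanLUImperfectDimGEFour :
    ∀ p : ℕ, p.Prime → PerfectResAt p → ∀ n : ℕ, 4 ≤ n → CleanLUAtDimImperfectAt p n := by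
  sorry

/-- STUB S3′ (per-ground-field TRANSFER of the tree's `P_reg` patching apparatus to `P_clean`; size L; no research content claimed): **clean Zariski
glue inside one imperfect ground field `k`** — clean LU at every centre of local dimension `n ≥ 4` of function fields over `k` and the clean
weak-sandwiched atom over `k` give `CleanModels|_{dim W ≥ 4}` over `k`.  Route = rev 2.2's S3 verbatim, which never leaves `k`: pick `g₀` with
`L = K(W)(g₀^{1/p})`; at a valuation of `K(W)/k` centred at a CLOSED point of `W` the centre has local dimension `dim W ≥ 4`, so S2′ gives a finitely
generated `A' ⊆ 𝒪_v` clean-regular at the centre (non-closed centres: refinement to a closed centre + generisation of `P_clean`, p659805, p660356,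
p660825 — dimension-free); Nagata-compactify `Spec A' → W` (`NagataCompactification_holds`); the `P_clean`-locus of a `W`-model is open and contains
the centre; `ZariskiRiemannSpace` quasi-compact ⟹ finitely many models whose `P_clean`-loci cover; reduce to one model by clean two-model patching,
which follows from S4′ exactly as `ProperModel.localRegLeification_of_sandwichedWeakResolution` + `localRegLeification_iff_twoModelPatching` do for
`P_reg`; finally G-form ↔ L-form (p657305).  Why it might fail: only if a `P_reg` step secretly uses more than «`P` open, stable under generisation,
produced by LU at the centre» — the tree's proofs do not (`ZariskiPatchingAllDimensions.lean`). [cite: Piltant2013, Prop. 4.2, Prop. 5.1; Zariski1944] -/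
theorem stub_cleanZariskiGlueImperfect :
    ∀ p : ℕ, p.Prime → (∀ n : ℕ, 4 ≤ n → CleanLUAtDimImperfectAt p n) → CleanSandwichedWeakImperfectAt p →
      CleanModelsDimGEFourImperfectAt p := by
  sorry

/-- STUB S4′ (OPEN — HARDEST, global; FRONTIER): **the clean weak-sandwiched atom in dimension `≥ 4` over IMPERFECT ground fields of characteristic
`p`, GIVEN resolution over all perfect fields of characteristic `p`** (`PerfectRes_p → CleanSandwichedWeakImperfectAt p`; rev 2.2's S4 restricted to
`¬ PerfectField k` and guarded — critic TRIAGE-7 §B4 `S4′`).  Why it might fail / why open: restricted to imperfect `k` it still contains plain weak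
resolution of every `d`-fold (`d ≥ 4`) proper birational over `𝔸ᵈ_k`, `k` imperfect (`sandwichedWeakOverCleanPairs_of_cleanSandwichedWeak` run at `p`
and `k`; `(𝔸ᵈ_k, x₁^{1/p})` is everywhere clean, `cleanRegAt_X_localization_mvPolynomial`) — OPEN (Piltant 2013 p. 1–2: sandwiched resolution «has
never been extended to dimensions higher than three»); the printed dimension-3 proofs use embedded resolution / principalization one dimension down
(Piltant 2013 Thm 2.4 axiom 4; CP 2019 Prop. 4.6 ff.); resolution over `k^{perf}` does not descend along `k^{perf}/k` (Disproof §3).  No counterexample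
known. [cite: Piltant2013, Thm. 2.4, p. 1-2; CossartPiltant2019, Thm. 1.1, Prop. 4.6] -/
theorem stub_cleanSandwichedWeakImperfectDimGEFour :
    ∀ p : ℕ, p.Prime → PerfectResAt p → CleanSandwichedWeakImperfectAt p := by
  sorry

/-! ## Composition concluding the crux BY NAME -/

/-- THE SKELETON THEOREM for the register (the ONLY theorem of this file concluding the item decl `Theses.Descent.DescentPerfectToAll`): the crux
from the four DECLARED STUBS by name (sorried) — for every prime `p` and under the crux's antecedent `H : PerfectRes_p`, S3′ applied to S2′ and S4′
(both fed `H`) is `CleanModels|_{dim ≥ 4, k imperfect}` at `p`, whence the crux by the sorry-free G1″ `descentPerfectToAll_of_cleanModelsImperfect`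
and S1.  No other hypothesis, no sorry here. [cite: CossartPiltant2019, Thm. 1.1] -/
theorem DescentPerfectToAll_proof :
    Summit.ResolutionOfSingularities.ResolutionOfSingularities.Theses.Descent.DescentPerfectToAll :=
  fun p hp H =>
    descentPerfectToAll_of_cleanModelsImperfect stub_cossartPiltant2019
      (fun q hq Hq => stub_cleanZariskiGlueImperfect q hq (stub_cleanLUImperfectDimGEFour q hq Hq)
        (stub_cleanSandwichedWeakImperfectDimGEFour q hq Hq)) p hp H

/-- COMPOSITION AS AN IMPLICATION (no sorry, no stub used), into the rfl-equal `EscapeRate` copy of the crux decl: the four stub STATEMENTS of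
rev 2.3 imply `DescentPerfectToAll` through G1″. [cite: CossartPiltant2019, Thm. 1.1] -/
theorem DescentPerfectToAll_of
    (h1 : Literature.AlgebraicGeometry.Resolution.CossartPiltant2019.{0})
    (h2 : ∀ p : ℕ, p.Prime → PerfectResAt p → ∀ n : ℕ, 4 ≤ n → CleanLUAtDimImperfectAt p n)
    (h3 : ∀ p : ℕ, p.Prime → (∀ n : ℕ, 4 ≤ n → CleanLUAtDimImperfectAt p n) → CleanSandwichedWeakImperfectAt p →
      CleanModelsDimGEFourImperfectAt p)
    (h4 : ∀ p : ℕ, p.Prime → PerfectResAt p → CleanSandwichedWeakImperfectAt p) :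
    Summit.ResolutionOfSingularities.ResolutionOfSingularities.Theses.EscapeRate.DescentPerfectToAll :=
  descentPerfectToAll_of_cleanModelsImperfect h1 fun p hp H => h3 p hp (h2 p hp H) (h4 p hp H)

/-- REV 2.2's composition, kept (no sorry, no stub used): the UNRESTRICTED statements S2, S3, S4 of rev 2.2 still imply the crux through the landed
G1 `Theorems.escapeRate_descentPerfectToAll_of_cleanModelsDimGEFour` (p654205).  Rev 2.3's cut is weaker stub by stub on the research side
(`cleanLUAtDimImperfectAt_of_cleanLUAtDim`, `cleanSandwichedWeakImperfectAt_of_cleanSandwichedWeak`); S3′ is S3 run inside one ground field.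
[cite: CossartPiltant2019, Thm. 1.1] -/
theorem DescentPerfectToAll_of_rev22
    (h1 : Literature.AlgebraicGeometry.Resolution.CossartPiltant2019.{0})
    (h2 : ∀ n : ℕ, 4 ≤ n → CleanLUAtDim n)
    (h3 : (∀ n : ℕ, 4 ≤ n → CleanLUAtDim n) → CleanSandwichedWeakDimGEFour → CleanModelsDimGEFour)
    (h4 : CleanSandwichedWeakDimGEFour) :
    Summit.ResolutionOfSingularities.ResolutionOfSingularities.Theses.EscapeRate.DescentPerfectToAll :=
  Summit.ResolutionOfSingularities.ResolutionOfSingularities.Theorems.escapeRate_descentPerfectToAll_of_cleanModelsDimGEFour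
    h1 (h3 h2 h4)

/-- With the candidate sub-cut of rev 2.2's S2 (cover LU + clean descent, typed, not registered) — composition through G1″ after restriction to
imperfect ground fields. [cite: CossartPiltant2019, Thm. 1.1] -/
theorem DescentPerfectToAll_of_subcut
    (h1 : Literature.AlgebraicGeometry.Resolution.CossartPiltant2019.{0})
    (h2a : ∀ n : ℕ, 4 ≤ n → CpCoverLUAtDim n) (h2b : ∀ n : ℕ, 4 ≤ n → CleanDescentAtDim n)
    (h3 : ∀ p : ℕ, p.Prime → (∀ n : ℕ, 4 ≤ n → CleanLUAtDimImperfectAt p n) → CleanSandwichedWeakImperfectAt p →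
      CleanModelsDimGEFourImperfectAt p)
    (h4 : ∀ p : ℕ, p.Prime → PerfectResAt p → CleanSandwichedWeakImperfectAt p) :
    Summit.ResolutionOfSingularities.ResolutionOfSingularities.Theses.EscapeRate.DescentPerfectToAll :=
  DescentPerfectToAll_of h1
    (fun p hp _ n hn => cleanLUAtDimImperfectAt_of_cleanLUAtDim (cleanLUDimGEFour_of_cover_of_descent h2a h2b n hn) p hp) h3 h4

/-- The two crux decls are one proposition (`rfl`), so `DescentPerfectToAll_of` is the skeleton theorem's content as an implication. [folklore] -/
theorem descent_eq_escapeRate :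
    Summit.ResolutionOfSingularities.ResolutionOfSingularities.Theses.Descent.DescentPerfectToAll =
      Summit.ResolutionOfSingularities.ResolutionOfSingularities.Theses.EscapeRate.DescentPerfectToAll := rfl

/-- … and so is the `WeightedInvariant` copy through which G1″ runs (`descentPerfectToAll_of_oneRootStepCore`). [folklore] -/
theorem descent_eq_weightedInvariant :
    Summit.ResolutionOfSingularities.ResolutionOfSingularities.Theses.Descent.DescentPerfectToAll =
      Summit.ResolutionOfSingularities.ResolutionOfSingularities.Theses.WeightedInvariant.DescentPerfectToAll := rfl

end Summit.ResolutionOfSingularities.ResolutionOfSingularities.Cruxes.DescentPerfectToAll.ViaCpFrame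

end
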